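import Literature.NumberTheory.LFunctions.DirichletLTruncationPacked
import HarnessLib

/-!
# Packed truncation certificates — the packed drift extraction of a leaf

For a leaf with `0/1` sign digits `d⁺, d⁻` (`L` digits), running value `pref`, uniform lower weight `wlo` and upper weight `c0h`
(the quantities of `LTruncationPacked.leafCell`), the packed vector
`V = (2^{b−1} + pref)·1 + wlo·C⁺ − c0h·C⁻` (`C^± =` prefix counts) is `kpack (offDigit b p)` for
`p_t = pref + wlo·C⁺_t − c0h·C⁻_t`, and the block-mask computation of `leafCell` returns `Σ_t max(0, −p_t)`
(range checks: `|pref| < 2^{P+15}`, `wlo, c0h < 2^{P+2}`, `L < 2^{12}`, `P + 30 ≤ b`). [cite: Chua2005RealZeros, §2.2 ALGO 1]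
-/

namespace Literature.NumberTheory.LFunctions

namespace LTruncationPacked

open Finset FeketePolyaKernel LTruncationCert Literature.Analysis.Convolution

section LeafD

variable {b P L : ℕ} {dP dM : ℕ → ℕ} {pref : ℤ} {wlo c0h : ℕ}

/-- The running lower bounds inside the leaf: `p_t = pref + wlo·C⁺_t − c0h·C⁻_t`. [cite: Chua2005RealZeros, §2.2 ALGO 1] -/
def prefRun (pref : ℤ) (wlo c0h : ℕ) (dP dM : ℕ → ℕ) (t : ℕ) : ℤ :=
  pref + ((wlo * psumF dP t : ℕ) : ℤ) - ((c0h * psumF dM t : ℕ) : ℤ)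

/-- Prefix counts of `0/1` digits are `≤ L < 2^{12}`. [folklore] -/
private theorem psumF_le (hd : ∀ j, dP j ≤ 1) (hL : L < 2 ^ 12) {t : ℕ} (ht : t < L) : psumF dP t < 2 ^ 12 := by
  have := psumF_le_mul dP ht (D := 1) (fun i _ => hd i)
  omega

/-- The running values are small: `|p_t| < 2^{P+16}` (the range check of the packed drift extraction). [cite: Chua2005RealZeros, §2.2 ALGO 1] -/
theorem prefRun_natAbs_lt (hL : L < 2 ^ 12) (hdP : ∀ j, dP j ≤ 1) (hdM : ∀ j, dM j ≤ 1)
    (hpref : pref.natAbs < 2 ^ (P + 15)) (hwlo : wlo < 2 ^ (P + 2)) (hc0h : c0h < 2 ^ (P + 2)) {t : ℕ} (ht : t < L) :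
    (prefRun pref wlo c0h dP dM t).natAbs < 2 ^ (P + 16) := by
  have h1 := psumF_le hdP hL ht
  have h2 := psumF_le hdM hL ht
  have hpow : 2 ^ (P + 2) * 2 ^ 12 = 2 ^ (P + 14) := by rw [← pow_add]
  have hw : wlo * psumF dP t ≤ 2 ^ (P + 14) := (Nat.mul_le_mul hwlo.le h1.le).trans hpow.le
  have hc : c0h * psumF dM t ≤ 2 ^ (P + 14) := (Nat.mul_le_mul hc0h.le h2.le).trans hpow.le
  have hpow2 : 2 ^ (P + 15) + 2 ^ (P + 14) + 2 ^ (P + 14) = 2 ^ (P + 16) := by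
    have : 2 ^ (P + 15) = 2 * 2 ^ (P + 14) := by rw [pow_succ]; ring
    have : 2 ^ (P + 16) = 2 * 2 ^ (P + 15) := by rw [pow_succ]; ring
    omega
  rw [prefRun]
  omega

/-- **The packed vector of the leaf is `kpack offDigit`.** [cite: Chua2005RealZeros, §2.2 ALGO 1] -/
theorem leafV_eq (hP : P + 30 ≤ b) (hL : L < 2 ^ 12) (hdP : ∀ j, dP j ≤ 1) (hdM : ∀ j, dM j ≤ 1)
    (hpref : pref.natAbs < 2 ^ (P + 15)) (hwlo : wlo < 2 ^ (P + 2)) (hc0h : c0h < 2 ^ (P + 2)) :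
    (((2 ^ (b - 1) : ℕ) : ℤ) + pref).toNat * onesV b L + wlo * kpack b L (psumF dP) - c0h * kpack b L (psumF dM) =
      kpack b L (offDigit b (prefRun pref wlo c0h dP dM)) := by
  have hb : 1 ≤ b := by omega
  obtain ⟨Hn, hHn⟩ : ∃ Hn : ℕ, Hn = 2 ^ (b - 1) := ⟨_, rfl⟩
  have hH : 2 ^ (P + 16) ≤ Hn := hHn ▸ Nat.pow_le_pow_right (by norm_num) (by omega)
  rw [← hHn]
  have h1516 : 2 ^ (P + 15) ≤ 2 ^ (P + 16) := Nat.pow_le_pow_right (by norm_num) (by omega)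
  have h1416 : 2 ^ (P + 14) ≤ 2 ^ (P + 15) := Nat.pow_le_pow_right (by norm_num) (by omega)
  have hpow : 2 ^ (P + 2) * 2 ^ 12 = 2 ^ (P + 14) := by rw [← pow_add]
  have hpa : -pref ≤ (pref.natAbs : ℤ) ∧ pref ≤ (pref.natAbs : ℤ) := by omega
  have hA0 : 0 ≤ (Hn : ℤ) + pref := by
    have : ((2 ^ (P + 15) : ℕ) : ℤ) ≤ ((Hn : ℕ) : ℤ) := by exact_mod_cast (h1516.trans hH)
    have h15 : ((pref.natAbs : ℕ) : ℤ) < ((2 ^ (P + 15) : ℕ) : ℤ) := by exact_mod_cast hpref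
    omega
  have hA : ((((Hn : ℕ) : ℤ) + pref).toNat : ℤ) = (Hn : ℤ) + pref := Int.toNat_of_nonneg hA0
  -- all the integer size facts, in `push_cast` normal form
  have hHz : (2 : ℤ) ^ (P + 16) ≤ (Hn : ℤ) := by exact_mod_cast hH
  have h15 : ((pref.natAbs : ℕ) : ℤ) < (2 : ℤ) ^ (P + 15) := by exact_mod_cast hpref
  have h216 : (2 : ℤ) ^ (P + 16) = 2 * 2 ^ (P + 15) := by rw [pow_succ]; ring
  have h215 : (2 : ℤ) ^ (P + 15) = 2 * 2 ^ (P + 14) := by rw [pow_succ]; ring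
  have hX : (0 : ℤ) ≤ 2 ^ (P + 14) := by positivity
  have hslot : ∀ j < L, (c0h : ℤ) * ((psumF dM j : ℕ) : ℤ) ≤ (2 : ℤ) ^ (P + 14) ∧
      (wlo : ℤ) * ((psumF dP j : ℕ) : ℤ) ≤ (2 : ℤ) ^ (P + 14) := fun j hj => by
    have hc : c0h * psumF dM j ≤ 2 ^ (P + 14) := (Nat.mul_le_mul hc0h.le (psumF_le hdM hL hj).le).trans hpow.le
    have hw : wlo * psumF dP j ≤ 2 ^ (P + 14) := (Nat.mul_le_mul hwlo.le (psumF_le hdP hL hj).le).trans hpow.le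
    exact ⟨by exact_mod_cast hc, by exact_mod_cast hw⟩
  have hsub : ∀ j < L, c0h * psumF dM j ≤ (((Hn : ℕ) : ℤ) + pref).toNat + wlo * psumF dP j := by
    intro j hj
    obtain ⟨hc, hw⟩ := hslot j hj
    have hw0 : (0 : ℤ) ≤ (wlo : ℤ) * ((psumF dP j : ℕ) : ℤ) := mul_nonneg (Nat.cast_nonneg _) (Nat.cast_nonneg _)
    have this : ((c0h * psumF dM j : ℕ) : ℤ) ≤ (((((Hn : ℕ) : ℤ) + pref).toNat + wlo * psumF dP j : ℕ) : ℤ) := by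
      rw [Nat.cast_add, hA, Nat.cast_mul, Nat.cast_mul]; linarith [hpa.1]
    exact (Nat.cast_le (α := ℤ)).mp this
  rw [affine_kpack hb hsub]
  refine kpack_congr fun j hj => ?_
  obtain ⟨hc, hw⟩ := hslot j hj
  rw [offDigit, prefRun, ← hHn]
  have hw0 : (0 : ℤ) ≤ (wlo : ℤ) * ((psumF dP j : ℕ) : ℤ) := mul_nonneg (Nat.cast_nonneg _) (Nat.cast_nonneg _)
  have hnn : 0 ≤ ((Hn : ℕ) : ℤ) + (pref + ((wlo * psumF dP j : ℕ) : ℤ) - ((c0h * psumF dM j : ℕ) : ℤ)) := by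
    rw [Nat.cast_mul, Nat.cast_mul]; linarith [hpa.1]
  have hsubj := hsub j hj
  have goalZ : ((((((Hn : ℕ) : ℤ) + pref).toNat + wlo * psumF dP j - c0h * psumF dM j : ℕ) : ℤ)) =
      (((((Hn : ℕ) : ℤ) + (pref + ((wlo * psumF dP j : ℕ) : ℤ) - ((c0h * psumF dM j : ℕ) : ℤ))).toNat : ℕ) : ℤ) := by
    rw [Nat.cast_sub hsubj, Int.toNat_of_nonneg hnn, Nat.cast_add, hA]
    push_cast
    ring
  exact (Nat.cast_inj (R := ℤ)).mp goalZ

/-- **The drift extraction of a leaf.** With `V = kpack (offDigit b p)` for the running values `p` of the leaf, the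
block-mask computation of `leafCell` (`H = 2^{b−1}`, `Bk = P + 16`) returns `Σ_{t<L} max(0, −p_t)`. [cite: Chua2005RealZeros, §2.2 ALGO 1] -/
theorem leaf_negsum_eq (hP : P + 30 ≤ b) (hL : L < 2 ^ 12) (hdP : ∀ j, dP j ≤ 1) (hdM : ∀ j, dM j ≤ 1)
    (hpref : pref.natAbs < 2 ^ (P + 15)) (hwlo : wlo < 2 ^ (P + 2)) (hc0h : c0h < 2 ^ (P + 2)) :
    let p := prefRun pref wlo c0h dP dM
    let V := kpack b L (offDigit b p)
    let U := V - (V &&& (2 ^ (b - 1) * onesV b L))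
    let NegI := (U &&& (2 ^ (P + 16) * onesV b L)) >>> (P + 16)
    let LoN := U &&& (NegI * (2 ^ (P + 16) - 1))
    (dsum b NegI <<< (P + 16)) - dsum b LoN = ∑ t ∈ range L, (-p t).toNat := by
  intro p V U NegI LoN
  have hBk : (P + 16) + 2 ≤ b := by omega
  have hp : ∀ j < L, (p j).natAbs < 2 ^ (P + 16) := fun j hj =>
    prefRun_natAbs_lt hL hdP hdM hpref hwlo hc0h hj
  have hU : U = kpack b L (lowDigit b p) := sub_land_top_eq hBk hp
  have hNegI : NegI = kpack b L (negInd p) := by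
    show (U &&& (2 ^ (P + 16) * onesV b L)) >>> (P + 16) = _
    rw [hU]; exact negInd_eq hBk hp
  have hLoN : LoN = kpack b L fun j => negInd p j * (2 ^ (P + 16) - (-p j).toNat) := by
    show U &&& (NegI * (2 ^ (P + 16) - 1)) = _
    rw [hU, hNegI]; exact lowBlocks_eq hBk hp
  rw [hNegI, hLoN]
  refine negsum_eq ?_ hp
  calc L * 2 ^ (P + 16) < 2 ^ 12 * 2 ^ (P + 16) := Nat.mul_lt_mul_of_pos_right hL (by positivity)
    _ = 2 ^ (P + 28) := by rw [← pow_add]; ring_nf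
    _ ≤ 2 ^ b - 1 := by
        have : 2 ^ (P + 28) < 2 ^ b := Nat.pow_lt_pow_right (by norm_num) (by omega)
        omega

end LeafD

end LTruncationPacked

end Literature.NumberTheory.LFunctions
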